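import Literature.MathematicalPhysics.QuantumFieldTheory.Balaban1983to89.B13OpsYPencilGreenPrime
import Literature.MathematicalPhysics.QuantumFieldTheory.Balaban1983to89.B13OpsYPencilAveraging
import Literature.MathematicalPhysics.QuantumFieldTheory.Balaban1983to89.B13EntryLetterAlgebraFamily

/-!
# `Balaban1983to89.B13OpsYPencilXQuad` — T. Bałaban, *Propagators for lattice gauge theories in a background field*, Commun. Math. Phys. **99**
(1985) 389–434 [Balaban1985BackgroundPropagators], (3.19)–(3.21) pp. 393–394 (`Q′(U)`), (3.24)–(3.25) pp. 394–395 (`Q′*`, «R(U) = I − G′Q′*(Q′G′²Q′*)⁻¹Q′G′»),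
Thm 3.2 p. 398 and (3.48) p. 398 (the operator `(Q′G′²Q′*)⁻¹`), Thm 3.4 p. 400, Sect. B (3.66)–(3.68) p. 403, (3.69)–(3.70) p. 404 («the operator Q′G′²Q′*(U′U) … analytic in A′»),
Thm 3.10 (3.107)–(3.108) p. 416; *Renormalization group approach to lattice gauge field theories. II*, Commun. Math. Phys. **116** (1988) 1–22
[Balaban1988RG2Cluster] (2.5)–(2.7) pp. 12–13, p. 15: THE SECOND INVERSE OF PRINT's CHAIN — `X(U) = Q′(U)G′(U)²Q′*(U)` (`Node00.XY`) AND
`X(U)⁻¹ = (Q′G′²Q′*)⁻¹(U)` (`Node00.XinvY`) IN THE N10 ENTRY-LETTER CURRENCY ALONG pv27's PENCIL.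

After the G′-junction (`B13OpsYPencilGreenPrime`: the letters of `A′ ↦ toMatrix (G′(e^{iηA′}U₀))` on the site sector), the block-sector operator
`X = Q′G′²Q′*` is a u-DEPENDENT LOCAL SANDWICH of the square family `G′²` by the RECTANGULAR block-averaging letters `Q′(U)`, `Q′*(U)` — exactly the
shape of the landed `B13EntryLetterAlgebraFamily.rawEntryLetters_sandwich_family` (dag-n10-w4, (D′)) once `Q′ ∕ Q′*` along the pencil are read as
rectangular coordinate matrices: the lane's module 73 (`B13OpsYPencilAveraging`: holomorphy, identification, bound with the support numeral `D`)
gives every ingredient.  THIS FILE (width seat n10-w2 g2, INTENT-7, the inverse road's second station):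
* §1 `toMatrix_piProd_rect_apply` — the RECTANGULAR product-basis matrix entry `toMatrix B′_X B′_Y Φ (y,k) (x,l) = b.repr (Φ(δ_x ⊗ b_l)(y)) k` (p599011 §1,
  two index types).
* §2 `Q′(U)`, `Q′*(U)` ALONG THE PENCIL AS RECTANGULAR LOCAL FAMILIES in (D′)'s hypothesis format, from 73 at `φ_k := (b.coord k).mkContinuous cb`:
  `toMatrix_QpY_eq` ∕ `toMatrix_QpsY_eq` (identification, any `U`: 68 `trLiftY_single`), `differentiableOn_toMatrix_QpY_prodCfg` ∕ `…QpsY…`, `norm_toMatrix_QpY_prodCfg_le` ∕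
  `…QpsY…` (`≤ |qpK(s,z)|·cb·(Kη^D·cl·Kη^D)`), `tdist_le_of_toMatrix_QpY_ne_zero` ∕ `…QpsY…` (range through the readings `ℓS`, `ℓB` with ONE numeral
  `r`: `qpK(s,z) ≠ 0 ⇒ d₁(ℓB s, ℓS z) ≤ r`), `rowSum_toMatrix_QpY_prodCfg_le` (row sums `≤ CQ·|κ|·cb·(Kη^D·cl·Kη^D)` from the kernel row-sum numeral
  `CQ ≥ Σ_z |qpK(s,z)|`), `colSum_toMatrix_QpsY_prodCfg_le` (column sums, numeral `CQs ≥ Σ_z |qpsK(z,s)|`).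
* §3 `toMatrix_XY_eq` (`toMatrix (X(U)) = toMatrix (Q′(U))·(toMatrix (G′(U))·toMatrix (G′(U)))·toMatrix (Q′*(U))`, `LinearMap.toMatrix_comp`), ★★
  `rawEntryLetters_toMatrix_XY_prodCfg` — from G′'s pencil letters `(R, ρ, B_G′)` on the site sector (the G′-junction's output, DISPLAYED so the files compose
  BY NAME), a fibre bound of `ℓS`, a rate loss `0 < μ ≤ ρ` (34 `rawEntryLetters_mul_torus` for `G′²`), and §2: `RawEntryLetters (A′ ↦ toMatrix (X(e^{iηA′}U₀)))
  (ℓB ∘ fst) R (ρ − μ) (a_Q·b_Q·(B_G′²·(m_S·c₀(1,μ)^ν))·e^{2(ρ−μ)r})` — print's «Q′G′²Q′*(U′U) … analytic in A′» ((3.66)–(3.70)) in the letter currency.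
* §4 ★★★ `rawEntryLetters_toMatrix_XinvY_prodCfg_of_pencil` — THE X⁻¹-JUNCTION: §3 fed to p601656 §5 (`…ringInverse_located_of_kernelBound`, `prodCfg_zero`,
  p599011 `XY_mul_XinvY`) ⟹ `RawEntryLetters (A′ ↦ toMatrix ((Q′G′²Q′*)⁻¹(e^{iηA′}U₀))) (ℓB ∘ fst) R₁⋆ ρ′ (2·cb·cl·B_X)` at the located thin radius, for every
  `0 ≤ ρ′ < ρ − μ`, displaying: G′'s pencil letters (the G′-junction), N06's `IsUnit (X(U₀))` + the pointwise (3.48)∕(3.108)-type bound for `X(U₀)⁻¹` at the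
  ONE real background (Thm 3.2 ∕ 3.10, GAPS G-B9-05∕06a∕07), NODE 00's numerals (`K₀`, `D`, `CQ`, `CQs`, `r`), the basis numerals, fibre bounds of `ℓS`,
  `ℓB`.  No `R₁`, no smallness, no complexification hypothesis.
HONEST FRAMING: readers + located numerals over the lane's 73, (D′), 34, p595959 ∕ p599011 ∕ p601656 ∕ p603690; NODE 00's `QpY ∕ QpsY ∕ qpK ∕ qpsK ∕ qpT ∕ XY ∕
XinvY ∕ GpY ∕ parSY` and pv27's `prodCfg` CONSUMED BY NAME, nothing of `Node00/OpsY*` modified; Theorem 3.2 ∕ 3.10 at the centre stays N06's displayed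
content; which `ℓS, ℓB, b, U₀, η` are «of record» is NODE 00's ∕ def-Y's ∕ def-T's word; nothing of Bałaban's asserted; N06 ∕ N10 NOT discharged; K1⁷ NOT
closed; counts unmoved (typed 28∕28 · discharged 5∕27); THEOREMS ONLY, 0 `sorry`, standard axioms; one finite 𝕋⁴ programme at fixed ε — R4 closes the
conditional finite-𝕋⁴ rung `BalabanLadder.UV` only; the YM mass gap (Clay) is NOT proved by any of this; nothing continuum ∕ ℝ⁴ ∕ OS.

References: T. Bałaban, CMP 99 (1985) 389–434 [Balaban1985BackgroundPropagators] (3.19)–(3.21) pp.393–394, (3.24)–(3.25) pp.394–395, Thm 3.2 (3.48)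
p.398, Thm 3.4 p.400, (3.66)–(3.68) p.403, (3.69)–(3.70) p.404, Thm 3.10 (3.107)–(3.108) pp.415–416; CMP 116 (1988) 1–22 [Balaban1988RG2Cluster] (2.5)–(2.7) pp.12–13, p.15;
CMP 96 (1984) 223–250 [Balaban1984PropagatorsII] (2.54) p.232, Lemma 2.1 (2.61) p.234.
DOC-ONLY EDITION (dag-n10-w2 g4, 2026-08-28): [B9] page locators corrected per the page owner lit-balaban-r06 — (3.25) p.394; (3.48) p.398; (3.60)–(3.65) p.402,
(3.66)–(3.68) p.403, (3.69)–(3.70) p.404, (3.71)–(3.72) p.405; (3.84)–(3.86) p.407 only; every declaration byte-identical to the previous edition.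
-/

noncomputable section

namespace Literature.MathematicalPhysics.QuantumFieldTheory.Balaban1983to89.B13OpsYPencilXQuad

open Metric Set Finset Module
open scoped Matrix
open Literature.MathematicalPhysics.QuantumFieldTheory.Balaban1983to89
open Literature.MathematicalPhysics.QuantumFieldTheory.Balaban1983to89.B9Thm37GlueTorus (tdist1 tdist1_comm tdist1_self tdist1_nonneg)
open Literature.MathematicalPhysics.QuantumFieldTheory.Balaban1983to89.B5TorusCover (UT)
open Literature.MathematicalPhysics.QuantumFieldTheory.Balaban1983to89.B13EntrywiseWalks (RawEntryLetters)
open Literature.MathematicalPhysics.QuantumFieldTheory.Balaban1983to89.B13EntryLetterAlgebra (rawEntryLetters_mono rawEntryLetters_congr rawEntryLetters_mul_torus)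
open Literature.MathematicalPhysics.QuantumFieldTheory.Balaban1983to89.B13EntryLetterAlgebraFamily (rawEntryLetters_sandwich_family)
open Literature.MathematicalPhysics.QuantumFieldTheory.Balaban1983to89.B13InverseOperatorCoordinates
  (toMatrix_piProd_apply rawEntryLetters_toMatrix_ringInverse_located_of_kernelBound XY_mul_XinvY)
open Literature.MathematicalPhysics.QuantumFieldTheory.Balaban1983to89.B13OpsYPencilAveraging
  (differentiableOn_coord_QpY_prodCfg coord_QpY_prodCfg_eq norm_coord_QpY_prodCfg_le
   differentiableOn_coord_QpsY_prodCfg coord_QpsY_prodCfg_eq norm_coord_QpsY_prodCfg_le)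
open Literature.MathematicalPhysics.QuantumFieldTheory.Balaban1983to89.B13TransportedLiftLetters (trLiftY_single)
open Literature.MathematicalPhysics.QuantumFieldTheory.Balaban1983to89.B9Eq39Adjoint (R R_def prodCfg)
open Literature.MathematicalPhysics.QuantumFieldTheory.Balaban1983to89.B9Eq369Product (prodCfg_zero)
open Literature.MathematicalPhysics.QuantumFieldTheory.Balaban1983to89.B6GlobalChartV1 (PV boxEquiv)
open Literature.MathematicalPhysics.QuantumFieldTheory.Balaban1983to89.B6KLevelCensusIndexV1 (KIdx)
open Literature.MathematicalPhysics.QuantumFieldTheory.Balaban1983to89.Node00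

/-! ## §1. The rectangular product-basis matrix entry -/

section Rect

variable {X Y κ 𝔸 : Type} [Fintype X] [DecidableEq X] [Fintype Y] [DecidableEq Y] [Fintype κ] [DecidableEq κ]
variable [AddCommGroup 𝔸] [Module ℂ 𝔸] (b : Basis κ ℂ 𝔸)

omit [DecidableEq Y] in
/-- ★ For a ℂ-linear `Φ : (X → 𝔸) → (Y → 𝔸)`: `toMatrix B′_X B′_Y Φ (y,k) (x,l) = b.repr (Φ(δ_x ⊗ b_l)(y)) k` (rectangular twin of p599011 §1).
[folklore] [cite: Balaban1985BackgroundPropagators, (3.107)–(3.108) p.416, dictionary] -/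
theorem toMatrix_piProd_rect_apply (Φ : (X → 𝔸) →ₗ[ℂ] (Y → 𝔸)) (i : Y × κ) (j : X × κ) :
    LinearMap.toMatrix ((Pi.basis fun _ : X => b).reindex (Equiv.sigmaEquivProd X κ))
      ((Pi.basis fun _ : Y => b).reindex (Equiv.sigmaEquivProd Y κ)) Φ i j = b.repr (Φ (Pi.single j.1 (b j.2)) i.1) i.2 := by
  obtain ⟨y, k⟩ := i
  obtain ⟨x, l⟩ := j
  rw [LinearMap.toMatrix_apply, Basis.reindex_apply, Basis.repr_reindex_apply]
  simp [Equiv.sigmaEquivProd, Pi.basis_apply, Pi.basis_repr]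

end Rect

variable {𝔸 : Type} [NormedRing 𝔸] [NormedAlgebra ℂ 𝔸] [CompleteSpace 𝔸]
variable {d ℓ : ℕ} {hd : 1 ≤ d + 1} {hL : Odd (ℓ + 1) ∧ 1 < ℓ + 1} {b₀ b₁ : ℝ}
variable (i : KIdx d ℓ hd hL b₀ b₁)
variable {κ : Type} [Fintype κ] [DecidableEq κ] (b : Basis κ ℂ 𝔸)
variable (U₀ : CfgY 𝔸 i) (η : ℝ) {Rc K₀ : ℝ} {D : ℕ}

/-! ## §2. `Q′(U)`, `Q′*(U)` along the pencil as rectangular local families -/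

section Averaging

variable [DecidableEq (SiteY i)] [DecidableEq (BlkY i)]

omit [DecidableEq (BlkY i)] in
/-- `Q′` IDENTIFIED: the rectangular matrix entry of NODE 00's `Q′(U) = (qpK)♯_{qpT}` is `qpK(s,z)·b.repr(R(qpT(U)(s,z)) b_l) k` — any `U`, any `par`
(68 `trLiftY_single`). [cite: Balaban1985BackgroundPropagators, (3.19), (3.21) pp.393–394] -/
theorem toMatrix_QpY_eq (parS : SiteParY 𝔸 i) (U : CfgY 𝔸 i) (s : BlkY i) (k : κ) (z : SiteY i) (l : κ) :
    LinearMap.toMatrix ((Pi.basis fun _ : SiteY i => b).reindex (Equiv.sigmaEquivProd (SiteY i) κ))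
      ((Pi.basis fun _ : BlkY i => b).reindex (Equiv.sigmaEquivProd (BlkY i) κ)) (QpY i parS U) (s, k) (z, l) =
      ((qpK i s z : ℝ) : ℂ) * b.repr (R (qpT i parS U s z) (b l)) k := by
  rw [toMatrix_piProd_rect_apply]
  show b.repr (trLiftY (qpK i) (qpT i parS U) (Pi.single z (b l)) s) k = _
  rw [trLiftY_single, map_smul, Finsupp.smul_apply, smul_eq_mul]

omit [DecidableEq (SiteY i)] in
/-- `Q′*` IDENTIFIED: `toMatrix(Q′*(U))(z,k)(s,l) = qpsK(z,s)·b.repr(R(qpT(U)(s,z)⁻¹) b_l) k`. [cite: Balaban1985BackgroundPropagators, (3.24) p.394] -/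
theorem toMatrix_QpsY_eq (parS : SiteParY 𝔸 i) (U : CfgY 𝔸 i) (z : SiteY i) (k : κ) (s : BlkY i) (l : κ) :
    LinearMap.toMatrix ((Pi.basis fun _ : BlkY i => b).reindex (Equiv.sigmaEquivProd (BlkY i) κ))
      ((Pi.basis fun _ : SiteY i => b).reindex (Equiv.sigmaEquivProd (SiteY i) κ)) (QpsY i parS U) (z, k) (s, l) =
      ((qpsK i z s : ℝ) : ℂ) * b.repr (R (qpT i parS U s z)⁻¹ (b l)) k := by
  rw [toMatrix_piProd_rect_apply]
  show b.repr (trLiftY (qpsK i) (fun z s => (qpT i parS U s z)⁻¹) (Pi.single s (b l)) z) k = _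
  rw [trLiftY_single, map_smul, Finsupp.smul_apply, smul_eq_mul]

omit [DecidableEq (BlkY i)] in
/-- `Q′` along the pencil: every rectangular matrix entry is HOLOMORPHIC (73 `differentiableOn_coord_QpY_prodCfg` at the coordinate functional
`(b.coord k).mkContinuous cb` — continuity from the numeral `cb`). [cite: Balaban1985BackgroundPropagators, (3.19), (3.21) pp.393–394, Thm 3.4 p.400] -/
theorem differentiableOn_toMatrix_QpY_prodCfg {cb : ℝ} (hcb : ∀ (x : 𝔸) (k : κ), ‖b.repr x k‖ ≤ cb * ‖x‖) (p : BlkY i × κ) (q : SiteY i × κ) :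
    DifferentiableOn ℂ (fun a : Fin (d + 1) → Site (PV d ℓ i.m i.K hd hL) 0 → 𝔸 =>
      LinearMap.toMatrix ((Pi.basis fun _ : SiteY i => b).reindex (Equiv.sigmaEquivProd (SiteY i) κ))
        ((Pi.basis fun _ : BlkY i => b).reindex (Equiv.sigmaEquivProd (BlkY i) κ)) (QpY i (parSY i) (prodCfg U₀ η a)) p q) (ball 0 Rc) := by
  obtain ⟨s, k⟩ := p
  obtain ⟨z, l⟩ := q
  have h := differentiableOn_coord_QpY_prodCfg i U₀ η (Rc := Rc)
    (fun k => (b.coord k).mkContinuous cb (fun x => by rw [Basis.coord_apply]; exact hcb x k)) b s z k l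
  refine h.congr fun a _ => ?_
  rw [toMatrix_QpY_eq, LinearMap.mkContinuous_apply, Basis.coord_apply]

omit [DecidableEq (SiteY i)] in
/-- `Q′*` along the pencil: every rectangular matrix entry is HOLOMORPHIC (73). [cite: Balaban1985BackgroundPropagators, (3.24) p.394, Thm 3.4 p.400] -/
theorem differentiableOn_toMatrix_QpsY_prodCfg {cb : ℝ} (hcb : ∀ (x : 𝔸) (k : κ), ‖b.repr x k‖ ≤ cb * ‖x‖) (q : SiteY i × κ) (p : BlkY i × κ) :
    DifferentiableOn ℂ (fun a : Fin (d + 1) → Site (PV d ℓ i.m i.K hd hL) 0 → 𝔸 =>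
      LinearMap.toMatrix ((Pi.basis fun _ : BlkY i => b).reindex (Equiv.sigmaEquivProd (BlkY i) κ))
        ((Pi.basis fun _ : SiteY i => b).reindex (Equiv.sigmaEquivProd (SiteY i) κ)) (QpsY i (parSY i) (prodCfg U₀ η a)) q p) (ball 0 Rc) := by
  obtain ⟨z, k⟩ := q
  obtain ⟨s, l⟩ := p
  have h := differentiableOn_coord_QpsY_prodCfg i U₀ η (Rc := Rc)
    (fun k => (b.coord k).mkContinuous cb (fun x => by rw [Basis.coord_apply]; exact hcb x k)) b z s k l
  refine h.congr fun a _ => ?_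
  rw [toMatrix_QpsY_eq, LinearMap.mkContinuous_apply, Basis.coord_apply]

variable {ν : ℕ} {Nf : Fin ν → ℕ} [∀ j, NeZero (Nf j)]

omit [DecidableEq (BlkY i)] in
/-- `Q′` along the pencil: RANGE through the readings `ℓB : BlkY i → UT Nf`, `ℓS : SiteY i → UT Nf` (one numeral `r`: `qpK(s,z) ≠ 0 ⇒ d₁(ℓB s, ℓS z) ≤ r` —
NODE 00's dictionary, displayed). [cite: Balaban1985BackgroundPropagators, (3.19) p.393 («x ∈ B^j(y)»), (3.108) p.416] -/
theorem tdist_le_of_toMatrix_QpY_ne_zero (ℓS : SiteY i → UT Nf) (ℓB : BlkY i → UT Nf) {r : ℝ}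
    (hℓQ : ∀ s z, qpK i s z ≠ 0 → tdist1 Nf (ℓB s) (ℓS z) ≤ r) (parS : SiteParY 𝔸 i) (U : CfgY 𝔸 i) (p : BlkY i × κ) (q : SiteY i × κ)
    (h : LinearMap.toMatrix ((Pi.basis fun _ : SiteY i => b).reindex (Equiv.sigmaEquivProd (SiteY i) κ))
      ((Pi.basis fun _ : BlkY i => b).reindex (Equiv.sigmaEquivProd (BlkY i) κ)) (QpY i parS U) p q ≠ 0) :
    tdist1 Nf (ℓB p.1) (ℓS q.1) ≤ r := by
  obtain ⟨s, k⟩ := p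
  obtain ⟨z, l⟩ := q
  refine hℓQ s z fun h0 => h ?_
  rw [toMatrix_QpY_eq, h0, Complex.ofReal_zero, zero_mul]

omit [DecidableEq (SiteY i)] in
/-- `Q′*` along the pencil: RANGE (`qpsK(z,s) ≠ 0 ⇒ d₁(ℓS z, ℓB s) ≤ r`, displayed). [cite: Balaban1985BackgroundPropagators, (3.24) p.394, (3.108) p.416] -/
theorem tdist_le_of_toMatrix_QpsY_ne_zero (ℓS : SiteY i → UT Nf) (ℓB : BlkY i → UT Nf) {r : ℝ}
    (hℓQs : ∀ z s, qpsK i z s ≠ 0 → tdist1 Nf (ℓS z) (ℓB s) ≤ r) (parS : SiteParY 𝔸 i) (U : CfgY 𝔸 i) (q : SiteY i × κ) (p : BlkY i × κ)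
    (h : LinearMap.toMatrix ((Pi.basis fun _ : BlkY i => b).reindex (Equiv.sigmaEquivProd (BlkY i) κ))
      ((Pi.basis fun _ : SiteY i => b).reindex (Equiv.sigmaEquivProd (SiteY i) κ)) (QpsY i parS U) q p ≠ 0) :
    tdist1 Nf (ℓS q.1) (ℓB p.1) ≤ r := by
  obtain ⟨z, k⟩ := q
  obtain ⟨s, l⟩ := p
  refine hℓQs z s fun h0 => h ?_
  rw [toMatrix_QpsY_eq, h0, Complex.ofReal_zero, zero_mul]

variable [NormOneClass 𝔸]

omit [DecidableEq (BlkY i)] in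
/-- `Q′` along the pencil: the ENTRY BOUND `≤ |qpK(s,z)|·(cb·(Kη^D·cl·Kη^D))` on `‖A′‖ < Rc` (73 `norm_coord_QpY_prodCfg_le` with `‖φ_k‖ ≤ cb`, `‖b_l‖ ≤ cl`).
[cite: Balaban1985BackgroundPropagators, (3.19), (3.21) pp.393–394, (3.40) p.397, (3.108) p.416] -/
theorem norm_toMatrix_QpY_prodCfg_le (hU : ∀ μ x, ‖(U₀ μ x : 𝔸)‖ ≤ K₀) (hUi : ∀ μ x, ‖(((U₀ μ x)⁻¹ : 𝔸ˣ) : 𝔸)‖ ≤ K₀) (hK1 : 1 ≤ K₀)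
    (hRc : 0 ≤ Rc) (hD : ∀ s z, qpK i s z ≠ 0 → Site.tdist ((boxEquiv i.hN).symm (blkCornerY i s)) ((boxEquiv i.hN).symm z) ≤ D)
    {cb cl : ℝ} (hcb : ∀ (x : 𝔸) (k : κ), ‖b.repr x k‖ ≤ cb * ‖x‖) (hcb0 : 0 ≤ cb) (hcl : ∀ l, ‖b l‖ ≤ cl)
    {a : Fin (d + 1) → Site (PV d ℓ i.m i.K hd hL) 0 → 𝔸} (ha : a ∈ ball 0 Rc) (p : BlkY i × κ) (q : SiteY i × κ) :
    ‖LinearMap.toMatrix ((Pi.basis fun _ : SiteY i => b).reindex (Equiv.sigmaEquivProd (SiteY i) κ))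
      ((Pi.basis fun _ : BlkY i => b).reindex (Equiv.sigmaEquivProd (BlkY i) κ)) (QpY i (parSY i) (prodCfg U₀ η a)) p q‖ ≤
      |qpK i p.1 q.1| * (cb * ((K₀ * Real.exp (|η| * Rc)) ^ D * cl * (K₀ * Real.exp (|η| * Rc)) ^ D)) := by
  obtain ⟨s, k⟩ := p
  obtain ⟨z, l⟩ := q
  set φ : κ → 𝔸 →L[ℂ] ℂ := fun k => (b.coord k).mkContinuous cb (fun x => by rw [Basis.coord_apply]; exact hcb x k) with hφ
  have e1 : LinearMap.toMatrix ((Pi.basis fun _ : SiteY i => b).reindex (Equiv.sigmaEquivProd (SiteY i) κ))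
      ((Pi.basis fun _ : BlkY i => b).reindex (Equiv.sigmaEquivProd (BlkY i) κ)) (QpY i (parSY i) (prodCfg U₀ η a)) (s, k) (z, l) =
      ((qpK i s z : ℝ) : ℂ) * φ k (R (qpT i (parSY i) (prodCfg U₀ η a) s z) (b l)) := by
    rw [toMatrix_QpY_eq, hφ, LinearMap.mkContinuous_apply, Basis.coord_apply]
  rw [e1]
  refine (norm_coord_QpY_prodCfg_le i U₀ η φ b hU hUi hK1 hRc hD ha s z k l).trans ?_
  have hKD : 0 ≤ (K₀ * Real.exp (|η| * Rc)) ^ D := pow_nonneg (mul_nonneg (zero_le_one.trans hK1) (Real.exp_nonneg _)) D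
  refine mul_le_mul_of_nonneg_left ?_ (abs_nonneg _)
  refine mul_le_mul (LinearMap.mkContinuous_norm_le _ hcb0 _) ?_ (by positivity) hcb0
  exact mul_le_mul_of_nonneg_right (mul_le_mul_of_nonneg_left (hcl l) hKD) hKD

omit [DecidableEq (SiteY i)] in
/-- `Q′*` along the pencil: the ENTRY BOUND `≤ |qpsK(z,s)|·(cb·(Kη^D·cl·Kη^D))` (73 `norm_coord_QpsY_prodCfg_le`).
[cite: Balaban1985BackgroundPropagators, (3.24) p.394, (3.40) p.397, (3.108) p.416] -/
theorem norm_toMatrix_QpsY_prodCfg_le (hU : ∀ μ x, ‖(U₀ μ x : 𝔸)‖ ≤ K₀) (hUi : ∀ μ x, ‖(((U₀ μ x)⁻¹ : 𝔸ˣ) : 𝔸)‖ ≤ K₀) (hK1 : 1 ≤ K₀)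
    (hRc : 0 ≤ Rc) (hDs : ∀ z s, qpsK i z s ≠ 0 → Site.tdist ((boxEquiv i.hN).symm (blkCornerY i s)) ((boxEquiv i.hN).symm z) ≤ D)
    {cb cl : ℝ} (hcb : ∀ (x : 𝔸) (k : κ), ‖b.repr x k‖ ≤ cb * ‖x‖) (hcb0 : 0 ≤ cb) (hcl : ∀ l, ‖b l‖ ≤ cl)
    {a : Fin (d + 1) → Site (PV d ℓ i.m i.K hd hL) 0 → 𝔸} (ha : a ∈ ball 0 Rc) (q : SiteY i × κ) (p : BlkY i × κ) :
    ‖LinearMap.toMatrix ((Pi.basis fun _ : BlkY i => b).reindex (Equiv.sigmaEquivProd (BlkY i) κ))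
      ((Pi.basis fun _ : SiteY i => b).reindex (Equiv.sigmaEquivProd (SiteY i) κ)) (QpsY i (parSY i) (prodCfg U₀ η a)) q p‖ ≤
      |qpsK i q.1 p.1| * (cb * ((K₀ * Real.exp (|η| * Rc)) ^ D * cl * (K₀ * Real.exp (|η| * Rc)) ^ D)) := by
  obtain ⟨z, k⟩ := q
  obtain ⟨s, l⟩ := p
  set φ : κ → 𝔸 →L[ℂ] ℂ := fun k => (b.coord k).mkContinuous cb (fun x => by rw [Basis.coord_apply]; exact hcb x k) with hφ
  have e1 : LinearMap.toMatrix ((Pi.basis fun _ : BlkY i => b).reindex (Equiv.sigmaEquivProd (BlkY i) κ))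
      ((Pi.basis fun _ : SiteY i => b).reindex (Equiv.sigmaEquivProd (SiteY i) κ)) (QpsY i (parSY i) (prodCfg U₀ η a)) (z, k) (s, l) =
      ((qpsK i z s : ℝ) : ℂ) * φ k (R (qpT i (parSY i) (prodCfg U₀ η a) s z)⁻¹ (b l)) := by
    rw [toMatrix_QpsY_eq, hφ, LinearMap.mkContinuous_apply, Basis.coord_apply]
  rw [e1]
  refine (norm_coord_QpsY_prodCfg_le i U₀ η φ b hU hUi hK1 hRc hDs ha z s k l).trans ?_
  have hKD : 0 ≤ (K₀ * Real.exp (|η| * Rc)) ^ D := pow_nonneg (mul_nonneg (zero_le_one.trans hK1) (Real.exp_nonneg _)) D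
  refine mul_le_mul_of_nonneg_left ?_ (abs_nonneg _)
  refine mul_le_mul (LinearMap.mkContinuous_norm_le _ hcb0 _) ?_ (by positivity) hcb0
  exact mul_le_mul_of_nonneg_right (mul_le_mul_of_nonneg_left (hcl l) hKD) hKD

omit [DecidableEq (BlkY i)] in
/-- `Q′` along the pencil: ROW SUMS `Σ_{(z,l)} ‖toMatrix(Q′)(s,k)(z,l)‖ ≤ CQ·|κ|·(cb·(Kη^D·cl·Kη^D))` from the kernel row-sum numeral `CQ ≥ Σ_z |qpK(s,z)|`
(print's averaging kernel has row sum `1`). [cite: Balaban1985BackgroundPropagators, (3.19) p.393; Balaban1984PropagatorsII, (2.54) p.232] -/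
theorem rowSum_toMatrix_QpY_prodCfg_le (hU : ∀ μ x, ‖(U₀ μ x : 𝔸)‖ ≤ K₀) (hUi : ∀ μ x, ‖(((U₀ μ x)⁻¹ : 𝔸ˣ) : 𝔸)‖ ≤ K₀) (hK1 : 1 ≤ K₀)
    (hRc : 0 ≤ Rc) (hD : ∀ s z, qpK i s z ≠ 0 → Site.tdist ((boxEquiv i.hN).symm (blkCornerY i s)) ((boxEquiv i.hN).symm z) ≤ D)
    {cb cl : ℝ} (hcb : ∀ (x : 𝔸) (k : κ), ‖b.repr x k‖ ≤ cb * ‖x‖) (hcb0 : 0 ≤ cb) (hcl : ∀ l, ‖b l‖ ≤ cl) (hcl0 : 0 ≤ cl)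
    {CQ : ℝ} (hCQ : ∀ s, ∑ z, |qpK i s z| ≤ CQ)
    {a : Fin (d + 1) → Site (PV d ℓ i.m i.K hd hL) 0 → 𝔸} (ha : a ∈ ball 0 Rc) (p : BlkY i × κ) :
    ∑ q : SiteY i × κ, ‖LinearMap.toMatrix ((Pi.basis fun _ : SiteY i => b).reindex (Equiv.sigmaEquivProd (SiteY i) κ))
      ((Pi.basis fun _ : BlkY i => b).reindex (Equiv.sigmaEquivProd (BlkY i) κ)) (QpY i (parSY i) (prodCfg U₀ η a)) p q‖ ≤
      CQ * (Fintype.card κ) * (cb * ((K₀ * Real.exp (|η| * Rc)) ^ D * cl * (K₀ * Real.exp (|η| * Rc)) ^ D)) := by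
  set c : ℝ := cb * ((K₀ * Real.exp (|η| * Rc)) ^ D * cl * (K₀ * Real.exp (|η| * Rc)) ^ D) with hc
  have hKD : 0 ≤ (K₀ * Real.exp (|η| * Rc)) ^ D := pow_nonneg (mul_nonneg (zero_le_one.trans hK1) (Real.exp_nonneg _)) D
  have hc0 : 0 ≤ c := mul_nonneg hcb0 (mul_nonneg (mul_nonneg hKD hcl0) hKD)
  calc ∑ q : SiteY i × κ, ‖LinearMap.toMatrix ((Pi.basis fun _ : SiteY i => b).reindex (Equiv.sigmaEquivProd (SiteY i) κ))
          ((Pi.basis fun _ : BlkY i => b).reindex (Equiv.sigmaEquivProd (BlkY i) κ)) (QpY i (parSY i) (prodCfg U₀ η a)) p q‖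
      ≤ ∑ q : SiteY i × κ, |qpK i p.1 q.1| * c :=
        Finset.sum_le_sum fun q _ => norm_toMatrix_QpY_prodCfg_le i b U₀ η hU hUi hK1 hRc hD hcb hcb0 hcl ha p q
    _ = (∑ z : SiteY i, |qpK i p.1 z|) * (Fintype.card κ) * c := by
        rw [Fintype.sum_prod_type, Finset.sum_mul, Finset.sum_mul]
        refine Finset.sum_congr rfl fun z _ => ?_
        show ∑ _y : κ, |qpK i p.1 z| * c = _
        rw [Finset.sum_const, Finset.card_univ, nsmul_eq_mul]
        ring
    _ ≤ CQ * (Fintype.card κ) * c :=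
        mul_le_mul_of_nonneg_right (mul_le_mul_of_nonneg_right (hCQ p.1) (Nat.cast_nonneg _)) hc0

omit [DecidableEq (SiteY i)] in
/-- `Q′*` along the pencil: COLUMN SUMS `Σ_{(z,l)} ‖toMatrix(Q′*)(z,l)(s,k)‖ ≤ CQs·|κ|·(cb·(Kη^D·cl·Kη^D))` from the numeral `CQs ≥ Σ_z |qpsK(z,s)|`.
[cite: Balaban1985BackgroundPropagators, (3.24) p.394; Balaban1984PropagatorsII, (2.54) p.232] -/
theorem colSum_toMatrix_QpsY_prodCfg_le (hU : ∀ μ x, ‖(U₀ μ x : 𝔸)‖ ≤ K₀) (hUi : ∀ μ x, ‖(((U₀ μ x)⁻¹ : 𝔸ˣ) : 𝔸)‖ ≤ K₀) (hK1 : 1 ≤ K₀)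
    (hRc : 0 ≤ Rc) (hDs : ∀ z s, qpsK i z s ≠ 0 → Site.tdist ((boxEquiv i.hN).symm (blkCornerY i s)) ((boxEquiv i.hN).symm z) ≤ D)
    {cb cl : ℝ} (hcb : ∀ (x : 𝔸) (k : κ), ‖b.repr x k‖ ≤ cb * ‖x‖) (hcb0 : 0 ≤ cb) (hcl : ∀ l, ‖b l‖ ≤ cl) (hcl0 : 0 ≤ cl)
    {CQs : ℝ} (hCQs : ∀ s, ∑ z, |qpsK i z s| ≤ CQs)
    {a : Fin (d + 1) → Site (PV d ℓ i.m i.K hd hL) 0 → 𝔸} (ha : a ∈ ball 0 Rc) (p : BlkY i × κ) :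
    ∑ q : SiteY i × κ, ‖LinearMap.toMatrix ((Pi.basis fun _ : BlkY i => b).reindex (Equiv.sigmaEquivProd (BlkY i) κ))
      ((Pi.basis fun _ : SiteY i => b).reindex (Equiv.sigmaEquivProd (SiteY i) κ)) (QpsY i (parSY i) (prodCfg U₀ η a)) q p‖ ≤
      CQs * (Fintype.card κ) * (cb * ((K₀ * Real.exp (|η| * Rc)) ^ D * cl * (K₀ * Real.exp (|η| * Rc)) ^ D)) := by
  set c : ℝ := cb * ((K₀ * Real.exp (|η| * Rc)) ^ D * cl * (K₀ * Real.exp (|η| * Rc)) ^ D) with hc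
  have hKD : 0 ≤ (K₀ * Real.exp (|η| * Rc)) ^ D := pow_nonneg (mul_nonneg (zero_le_one.trans hK1) (Real.exp_nonneg _)) D
  have hc0 : 0 ≤ c := mul_nonneg hcb0 (mul_nonneg (mul_nonneg hKD hcl0) hKD)
  calc ∑ q : SiteY i × κ, ‖LinearMap.toMatrix ((Pi.basis fun _ : BlkY i => b).reindex (Equiv.sigmaEquivProd (BlkY i) κ))
          ((Pi.basis fun _ : SiteY i => b).reindex (Equiv.sigmaEquivProd (SiteY i) κ)) (QpsY i (parSY i) (prodCfg U₀ η a)) q p‖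
      ≤ ∑ q : SiteY i × κ, |qpsK i q.1 p.1| * c :=
        Finset.sum_le_sum fun q _ => norm_toMatrix_QpsY_prodCfg_le i b U₀ η hU hUi hK1 hRc hDs hcb hcb0 hcl ha q p
    _ = (∑ z : SiteY i, |qpsK i z p.1|) * (Fintype.card κ) * c := by
        rw [Fintype.sum_prod_type, Finset.sum_mul, Finset.sum_mul]
        refine Finset.sum_congr rfl fun z _ => ?_
        show ∑ _y : κ, |qpsK i z p.1| * c = _
        rw [Finset.sum_const, Finset.card_univ, nsmul_eq_mul]
        ring
    _ ≤ CQs * (Fintype.card κ) * c :=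
        mul_le_mul_of_nonneg_right (mul_le_mul_of_nonneg_right (hCQs p.1) (Nat.cast_nonneg _)) hc0

end Averaging

/-! ## §3. ★★ `X = Q′G′²Q′*` along the pencil -/

section XQuad

variable [DecidableEq (SiteY i)] [DecidableEq (BlkY i)]

/-- The matrix of `X(U) = Q′(U)G′(U)G′(U)Q′*(U)` is the product of the rectangular ∕ square matrices of its letters (`LinearMap.toMatrix_comp`).
[cite: Balaban1985BackgroundPropagators, (3.25) p.394, (3.66) p.403] -/
theorem toMatrix_XY_eq (parS : SiteParY 𝔸 i) (Gp : SiteOpY 𝔸 i) (U : CfgY 𝔸 i) :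
    LinearMap.toMatrix ((Pi.basis fun _ : BlkY i => b).reindex (Equiv.sigmaEquivProd (BlkY i) κ))
      ((Pi.basis fun _ : BlkY i => b).reindex (Equiv.sigmaEquivProd (BlkY i) κ)) (XY i parS Gp U) =
    LinearMap.toMatrix ((Pi.basis fun _ : SiteY i => b).reindex (Equiv.sigmaEquivProd (SiteY i) κ))
        ((Pi.basis fun _ : BlkY i => b).reindex (Equiv.sigmaEquivProd (BlkY i) κ)) (QpY i parS U) *
      (LinearMap.toMatrix ((Pi.basis fun _ : SiteY i => b).reindex (Equiv.sigmaEquivProd (SiteY i) κ))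
          ((Pi.basis fun _ : SiteY i => b).reindex (Equiv.sigmaEquivProd (SiteY i) κ)) (Gp U) *
        LinearMap.toMatrix ((Pi.basis fun _ : SiteY i => b).reindex (Equiv.sigmaEquivProd (SiteY i) κ))
          ((Pi.basis fun _ : SiteY i => b).reindex (Equiv.sigmaEquivProd (SiteY i) κ)) (Gp U)) *
      LinearMap.toMatrix ((Pi.basis fun _ : BlkY i => b).reindex (Equiv.sigmaEquivProd (BlkY i) κ))
        ((Pi.basis fun _ : SiteY i => b).reindex (Equiv.sigmaEquivProd (SiteY i) κ)) (QpsY i parS U) := by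
  have hX : XY i parS Gp U = QpY i parS U ∘ₗ (Gp U ∘ₗ (Gp U ∘ₗ QpsY i parS U)) := rfl
  rw [hX, LinearMap.toMatrix_comp _ ((Pi.basis fun _ : SiteY i => b).reindex (Equiv.sigmaEquivProd (SiteY i) κ)),
    LinearMap.toMatrix_comp _ ((Pi.basis fun _ : SiteY i => b).reindex (Equiv.sigmaEquivProd (SiteY i) κ)),
    LinearMap.toMatrix_comp _ ((Pi.basis fun _ : SiteY i => b).reindex (Equiv.sigmaEquivProd (SiteY i) κ)), Matrix.mul_assoc,
    Matrix.mul_assoc]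

variable [NormOneClass 𝔸]
variable {ν : ℕ} {Nf : Fin ν → ℕ} [∀ j, NeZero (Nf j)]

/-- ★★ **`X = Q′G′²Q′*` ALONG THE PENCIL IN N10 COORDINATES** — print's «the operator Q′G′²Q′*(U′U) … analytic in A′» ((3.66)–(3.70)) in the letter
currency: from G′'s pencil letters `(R, ρ, B_G′)` on the site sector (the G′-junction's output — displayed), a fibre bound `m_S` of `ℓS`, a rate loss
`0 < μ ≤ ρ` (34 `rawEntryLetters_mul_torus` for `G′²`), §2's rectangular data of `Q′ ∕ Q′*` (background size, support numeral `D`, kernel row ∕ column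
sums `CQ, CQs ≥ 0`, reading numeral `r`, basis numerals `cb, cl ≥ 0`), on the common chart ball `‖A′‖ < R` (`0 ≤ R`):
`RawEntryLetters (A′ ↦ toMatrix (X(e^{iηA′}U₀))) (ℓB ∘ fst) R (ρ − μ) (a_Q·b_Q·(B_G′·B_G′·(m_S·c₀(1,μ)^ν))·e^{2(ρ−μ)r})` — (D′) `rawEntryLetters_sandwich_family`.
[cite: Balaban1985BackgroundPropagators, (3.25) p.394, Thm 3.4 p.400, (3.66)–(3.68) p.403, (3.69)–(3.70) p.404, Thm 3.10 (3.108) p.416; Balaban1988RG2Cluster, (2.5)–(2.6) p.12;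
Balaban1984PropagatorsII, (2.54) p.232, Lemma 2.1 (2.61) p.234] -/
theorem rawEntryLetters_toMatrix_XY_prodCfg {R : ℝ}
    (hU : ∀ μ x, ‖(U₀ μ x : 𝔸)‖ ≤ K₀) (hUi : ∀ μ x, ‖(((U₀ μ x)⁻¹ : 𝔸ˣ) : 𝔸)‖ ≤ K₀) (hK1 : 1 ≤ K₀) (hR0 : 0 ≤ R)
    (hD : ∀ s z, qpK i s z ≠ 0 → Site.tdist ((boxEquiv i.hN).symm (blkCornerY i s)) ((boxEquiv i.hN).symm z) ≤ D)
    (hDs : ∀ z s, qpsK i z s ≠ 0 → Site.tdist ((boxEquiv i.hN).symm (blkCornerY i s)) ((boxEquiv i.hN).symm z) ≤ D)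
    {CQ CQs : ℝ} (hCQ0 : 0 ≤ CQ) (hCQ : ∀ s, ∑ z, |qpK i s z| ≤ CQ) (hCQs0 : 0 ≤ CQs) (hCQs : ∀ s, ∑ z, |qpsK i z s| ≤ CQs)
    {cb cl : ℝ} (hcb : ∀ (x : 𝔸) (k : κ), ‖b.repr x k‖ ≤ cb * ‖x‖) (hcb0 : 0 ≤ cb) (hcl : ∀ l, ‖b l‖ ≤ cl) (hcl0 : 0 ≤ cl)
    (ℓS : SiteY i → UT Nf) (ℓB : BlkY i → UT Nf) {r : ℝ}
    (hℓQ : ∀ s z, qpK i s z ≠ 0 → tdist1 Nf (ℓB s) (ℓS z) ≤ r) (hℓQs : ∀ z s, qpsK i z s ≠ 0 → tdist1 Nf (ℓS z) (ℓB s) ≤ r)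
    {mS : ℕ} (hfibS : ∀ y : UT Nf, (univ.filter fun q : SiteY i × κ => ℓS q.1 = y).card ≤ mS)
    {ρ BG μ : ℝ}
    (hG : RawEntryLetters (fun a : Fin (d + 1) → Site (PV d ℓ i.m i.K hd hL) 0 → 𝔸 =>
      LinearMap.toMatrix ((Pi.basis fun _ : SiteY i => b).reindex (Equiv.sigmaEquivProd (SiteY i) κ))
        ((Pi.basis fun _ : SiteY i => b).reindex (Equiv.sigmaEquivProd (SiteY i) κ)) (GpY i (parSY i) (prodCfg U₀ η a)))
      (fun q : SiteY i × κ => ℓS q.1) R ρ BG)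
    (hμ : 0 < μ) (hμρ : μ ≤ ρ) :
    RawEntryLetters (fun a : Fin (d + 1) → Site (PV d ℓ i.m i.K hd hL) 0 → 𝔸 =>
        LinearMap.toMatrix ((Pi.basis fun _ : BlkY i => b).reindex (Equiv.sigmaEquivProd (BlkY i) κ))
          ((Pi.basis fun _ : BlkY i => b).reindex (Equiv.sigmaEquivProd (BlkY i) κ)) (XY i (parSY i) (GpY i (parSY i)) (prodCfg U₀ η a)))
      (fun p : BlkY i × κ => ℓB p.1) R (ρ - μ)
      (CQ * (Fintype.card κ) * (cb * ((K₀ * Real.exp (|η| * R)) ^ D * cl * (K₀ * Real.exp (|η| * R)) ^ D)) *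
        (CQs * (Fintype.card κ) * (cb * ((K₀ * Real.exp (|η| * R)) ^ D * cl * (K₀ * Real.exp (|η| * R)) ^ D))) *
        (BG * BG * (mS * B6.c0 1 μ ^ ν)) * Real.exp (2 * (ρ - μ) * r)) := by
  -- `G′²` along the pencil: one rate loss (34)
  have hG2 := rawEntryLetters_mul_torus hG hG hμ (κ := ρ - μ) (by linarith) (by linarith) (by linarith) hfibS
  -- nonnegativity of the two rectangular sum numerals
  have hKD : 0 ≤ (K₀ * Real.exp (|η| * R)) ^ D := pow_nonneg (mul_nonneg (zero_le_one.trans hK1) (Real.exp_nonneg _)) D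
  have hc0 : 0 ≤ cb * ((K₀ * Real.exp (|η| * R)) ^ D * cl * (K₀ * Real.exp (|η| * R)) ^ D) :=
    mul_nonneg hcb0 (mul_nonneg (mul_nonneg hKD hcl0) hKD)
  have ha0 : 0 ≤ CQ * (Fintype.card κ) * (cb * ((K₀ * Real.exp (|η| * R)) ^ D * cl * (K₀ * Real.exp (|η| * R)) ^ D)) :=
    mul_nonneg (mul_nonneg hCQ0 (Nat.cast_nonneg _)) hc0
  have hb0 : 0 ≤ CQs * (Fintype.card κ) * (cb * ((K₀ * Real.exp (|η| * R)) ^ D * cl * (K₀ * Real.exp (|η| * R)) ^ D)) :=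
    mul_nonneg (mul_nonneg hCQs0 (Nat.cast_nonneg _)) hc0
  -- (D′)'s sandwich with the local rectangular letters `Q′ ∕ Q′*`
  have hS := rawEntryLetters_sandwich_family (locp := fun p : BlkY i × κ => ℓB p.1) hG2 (by linarith)
    (A := fun a => LinearMap.toMatrix ((Pi.basis fun _ : SiteY i => b).reindex (Equiv.sigmaEquivProd (SiteY i) κ))
        ((Pi.basis fun _ : BlkY i => b).reindex (Equiv.sigmaEquivProd (BlkY i) κ)) (QpY i (parSY i) (prodCfg U₀ η a)))
    (B' := fun a => LinearMap.toMatrix ((Pi.basis fun _ : BlkY i => b).reindex (Equiv.sigmaEquivProd (BlkY i) κ))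
        ((Pi.basis fun _ : SiteY i => b).reindex (Equiv.sigmaEquivProd (SiteY i) κ)) (QpsY i (parSY i) (prodCfg U₀ η a)))
    (r := r) ha0 hb0
    (fun p q => differentiableOn_toMatrix_QpY_prodCfg i b U₀ η hcb p q)
    (fun a _ p q hne => tdist_le_of_toMatrix_QpY_ne_zero i b ℓS ℓB hℓQ (parSY i) (prodCfg U₀ η a) p q hne)
    (fun a ha p => rowSum_toMatrix_QpY_prodCfg_le i b U₀ η hU hUi hK1 hR0 hD hcb hcb0 hcl hcl0 hCQ ha p)
    (fun q p => differentiableOn_toMatrix_QpsY_prodCfg i b U₀ η hcb q p)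
    (fun a _ q p hne => tdist_le_of_toMatrix_QpsY_ne_zero i b ℓS ℓB hℓQs (parSY i) (prodCfg U₀ η a) q p hne)
    (fun a ha p => colSum_toMatrix_QpsY_prodCfg_le i b U₀ η hU hUi hK1 hR0 hDs hcb hcb0 hcl hcl0 hCQs ha p)
  refine rawEntryLetters_congr hS fun a _ => ?_
  rw [toMatrix_XY_eq]

end XQuad

/-! ## §4. ★★★ THE X⁻¹-JUNCTION: `(Q′G′²Q′*)⁻¹(e^{iηA′}U₀)` in N10 coordinates -/

section XInv

variable [DecidableEq (SiteY i)] [DecidableEq (BlkY i)] [NormOneClass 𝔸]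
variable {ν : ℕ} {Nf : Fin ν → ℕ} [∀ j, NeZero (Nf j)]

/-- ★★★ **THE X⁻¹-JUNCTION — SECT. B FOR `(Q′G′²Q′*)⁻¹` AT NODE 00's OBJECTS.**  Along pv27's pencil, the matrices of NODE 00's `XinvY = (Q′G′²Q′*)⁻¹`
(with `G′ := GpY i (parSY i)`, `Q′ := QpY i (parSY i)`) in the product basis of the block sector have the N10 letters
`RawEntryLetters (A′ ↦ toMatrix ((Q′G′²Q′*)⁻¹(e^{iηA′}U₀))) (ℓB ∘ fst) R₁⋆ ρ′ (2·cb·cl·B_X)` at the located thin radius (p595959 ∕ p601656 §5), for every target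
rate `0 ≤ ρ′ < ρ − μ`.  DISPLAYED: §3's inputs (G′'s pencil letters — the G′-junction's output —, `Q′`'s numerals, readings, basis numerals, fibre bounds) and
N06's content at the ONE real background `U₀`: `IsUnit (X(U₀))` and the pointwise (3.48) ∕ (3.108)-type kernel bound `‖X(U₀)⁻¹(δ_s ⊗ E)(t)‖ ≤
B_X‖E‖e^{−(ρ−μ) d(ℓB t, ℓB s)}` (Thm 3.2 ∕ 3.10; GAPS G-B9-05∕06a∕07).  No `R₁`, no smallness, no complexification hypothesis.
[cite: Balaban1985BackgroundPropagators, (3.25) p.394, Thm 3.2 p.398, (3.48) p.398, Thm 3.4 p.400, (3.66)–(3.68) p.403, (3.69)–(3.70) p.404, Thm 3.10 (3.107)–(3.108) p.416;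
Balaban1988RG2Cluster, (2.5)–(2.7) pp.12–13, p.15; Balaban1984PropagatorsII, Lemma 2.1 (2.61) p.234] -/
theorem rawEntryLetters_toMatrix_XinvY_prodCfg_of_pencil {R : ℝ}
    (hU : ∀ μ x, ‖(U₀ μ x : 𝔸)‖ ≤ K₀) (hUi : ∀ μ x, ‖(((U₀ μ x)⁻¹ : 𝔸ˣ) : 𝔸)‖ ≤ K₀) (hK1 : 1 ≤ K₀) (hR : 0 < R)
    (hD : ∀ s z, qpK i s z ≠ 0 → Site.tdist ((boxEquiv i.hN).symm (blkCornerY i s)) ((boxEquiv i.hN).symm z) ≤ D)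
    (hDs : ∀ z s, qpsK i z s ≠ 0 → Site.tdist ((boxEquiv i.hN).symm (blkCornerY i s)) ((boxEquiv i.hN).symm z) ≤ D)
    {CQ CQs : ℝ} (hCQ0 : 0 ≤ CQ) (hCQ : ∀ s, ∑ z, |qpK i s z| ≤ CQ) (hCQs0 : 0 ≤ CQs) (hCQs : ∀ s, ∑ z, |qpsK i z s| ≤ CQs)
    {cb cl : ℝ} (hcb : ∀ (x : 𝔸) (k : κ), ‖b.repr x k‖ ≤ cb * ‖x‖) (hcb0 : 0 ≤ cb) (hcl : ∀ l, ‖b l‖ ≤ cl) (hcl0 : 0 ≤ cl)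
    (ℓS : SiteY i → UT Nf) (ℓB : BlkY i → UT Nf) {r : ℝ}
    (hℓQ : ∀ s z, qpK i s z ≠ 0 → tdist1 Nf (ℓB s) (ℓS z) ≤ r) (hℓQs : ∀ z s, qpsK i z s ≠ 0 → tdist1 Nf (ℓS z) (ℓB s) ≤ r)
    {mS mB : ℕ} (hfibS : ∀ y : UT Nf, (univ.filter fun q : SiteY i × κ => ℓS q.1 = y).card ≤ mS)
    (hfibB : ∀ y : UT Nf, (univ.filter fun p : BlkY i × κ => ℓB p.1 = y).card ≤ mB)
    {ρ BG μ : ℝ}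
    (hG : RawEntryLetters (fun a : Fin (d + 1) → Site (PV d ℓ i.m i.K hd hL) 0 → 𝔸 =>
      LinearMap.toMatrix ((Pi.basis fun _ : SiteY i => b).reindex (Equiv.sigmaEquivProd (SiteY i) κ))
        ((Pi.basis fun _ : SiteY i => b).reindex (Equiv.sigmaEquivProd (SiteY i) κ)) (GpY i (parSY i) (prodCfg U₀ η a)))
      (fun q : SiteY i × κ => ℓS q.1) R ρ BG)
    (hμ : 0 < μ) (hμρ : μ ≤ ρ)
    -- N06's content at the ONE real background `U₀` for the operator `X = Q′G′²Q′*`: invertibility (Thm 3.2) and the kernel bound of its inverse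
    (hunit : IsUnit (XY i (parSY i) (GpY i (parSY i)) U₀)) {BX : ℝ} (hBX : 0 ≤ BX)
    (hO : ∀ s t (E : 𝔸), ‖XinvY i (parSY i) (GpY i (parSY i)) U₀ (Pi.single s E) t‖ ≤
      BX * ‖E‖ * Real.exp (-((ρ - μ) * tdist1 Nf (ℓB t) (ℓB s))))
    {ρ' : ℝ} (hρ'0 : 0 ≤ ρ') (hρ' : ρ' < ρ - μ) :
    RawEntryLetters (fun a : Fin (d + 1) → Site (PV d ℓ i.m i.K hd hL) 0 → 𝔸 =>
        LinearMap.toMatrix ((Pi.basis fun _ : BlkY i => b).reindex (Equiv.sigmaEquivProd (BlkY i) κ))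
          ((Pi.basis fun _ : BlkY i => b).reindex (Equiv.sigmaEquivProd (BlkY i) κ)) (XinvY i (parSY i) (GpY i (parSY i)) (prodCfg U₀ η a)))
      (fun p : BlkY i × κ => ℓB p.1)
      (R / (4 * ((CQ * (Fintype.card κ) * (cb * ((K₀ * Real.exp (|η| * R)) ^ D * cl * (K₀ * Real.exp (|η| * R)) ^ D)) *
          (CQs * (Fintype.card κ) * (cb * ((K₀ * Real.exp (|η| * R)) ^ D * cl * (K₀ * Real.exp (|η| * R)) ^ D))) *
          (BG * BG * (mS * B6.c0 1 μ ^ ν)) * Real.exp (2 * (ρ - μ) * r)) * (cb * cl * BX) *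
          (mB * B6.c0 1 ((ρ - μ - ρ') / 3) ^ ν) * (mB * B6.c0 1 ((ρ - μ - ρ') / 3) ^ ν)) + 1))
      ρ' (2 * (cb * cl * BX)) := by
  have hX := rawEntryLetters_toMatrix_XY_prodCfg i b U₀ η hU hUi hK1 hR.le hD hDs hCQ0 hCQ hCQs0 hCQs hcb hcb0 hcl hcl0 ℓS ℓB hℓQ hℓQs
    hfibS hG hμ hμρ
  have h0 : XY i (parSY i) (GpY i (parSY i)) (prodCfg U₀ η 0) * XinvY i (parSY i) (GpY i (parSY i)) U₀ = 1 := by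
    rw [prodCfg_zero]
    exact XY_mul_XinvY i hunit
  exact rawEntryLetters_toMatrix_ringInverse_located_of_kernelBound b (fun a => XY i (parSY i) (GpY i (parSY i)) (prodCfg U₀ η a)) ℓB hX h0
    hcb hcb0 hcl hcl0 hBX hO hfibB hR hρ'0 hρ'

end XInv

end Literature.MathematicalPhysics.QuantumFieldTheory.Balaban1983to89.B13OpsYPencilXQuad

end
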